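import Literature.Combinatorics.Designs.MannSubsquareObstruction

/-!
# At most `n - 1` mutually orthogonal Latin squares of order `n` (kernel)
Framing: lottery ticket; floor = certified bounds/negative ranges.

Cell pub-namedobj (venture DiscreteObjects), target (M), designs gen 9.  The classical bound `N(n) ≤ n - 1` (so that the eleven
squares of `PlaneOfMOLS` / `CompleteMOLSOfPlane` form a COMPLETE set for `n = 12`, and `N(10) ≤ 9` is the trivial end of the MOLS(10)
floor `2 ≤ N(10) ≤ 6`): **`card_MOLS_le`** — a family `Ls : ι → Fin n → Fin n → Fin n` of Latin squares, pairwise orthogonal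
(`Literature…LatinSquares`), with `2 ≤ n`, has `|ι| ≤ n - 1`.  Proof (Keedwell–Dénes 2015, Thm 5.1.x, the standard one): relabel
the symbols of each square so that its first row reads `0, 1, …, n-1` (relabelling preserves orthogonality); the entries in the
cell `(1, 0)` are then `≠ 0` and pairwise distinct (a repeated entry `s` would repeat the pair `(s, s)` already seen in the cell
`(0, s)`), an injection `ι ↪ {s : Fin n // s ≠ 0}`.  Formalisation ours; no `sorry`.
-/

namespace Summit.Ventures.DiscreteObjects.MOLS

open Function Literature.Combinatorics.Designs.LatinSquares

variable {ι : Type*} {n : ℕ}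

/-- the symbol relabelling that normalises the first row of a Latin square: `ρ (L 0 b) = b` -/
noncomputable def rowPerm (L : Fin n → Fin n → Fin n) (hL : IsLatinSquare L) (z : Fin n) : Equiv.Perm (Fin n) :=
  (Equiv.ofBijective (L z) (Finite.injective_iff_bijective.mp (hL.1 z))).symm

/-- `ρ (L z b) = b` -/
theorem rowPerm_apply (L : Fin n → Fin n → Fin n) (hL : IsLatinSquare L) (z b : Fin n) : rowPerm L hL z (L z b) = b := by
  unfold rowPerm
  rw [Equiv.symm_apply_eq]
  rfl

/-- relabelling the symbols of both squares preserves orthogonality -/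
theorem isOrthogonalMate_relabel {L M : Fin n → Fin n → Fin n} (h : IsOrthogonalMate L M) (γ δ : Equiv.Perm (Fin n)) :
    IsOrthogonalMate (fun i b => γ (L i b)) (fun i b => δ (M i b)) := by
  rintro ⟨i, b⟩ ⟨i', b'⟩ hpq
  simp only [Prod.mk.injEq, EmbeddingLike.apply_eq_iff_eq] at hpq
  exact h (Prod.ext hpq.1 hpq.2)

/-- **`N(n) ≤ n - 1`:** pairwise orthogonal Latin squares of order `n ≥ 2` number at most `n - 1`. -/
theorem card_MOLS_le [Fintype ι] (Ls : ι → Fin n → Fin n → Fin n) (hL : ∀ k, IsLatinSquare (Ls k))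
    (hO : ∀ k k', k ≠ k' → IsOrthogonalMate (Ls k) (Ls k')) (hn : 2 ≤ n) : Fintype.card ι ≤ n - 1 := by
  classical
  have h0 : 0 < n := by omega
  set z : Fin n := ⟨0, h0⟩ with hz
  set o : Fin n := ⟨1, by omega⟩ with ho
  have hzo : o ≠ z := by simp [hz, ho, Fin.ext_iff]
  -- normalised entry in the cell (1, 0)
  let f : ι → Fin n := fun k => rowPerm (Ls k) (hL k) z (Ls k o z)
  have hf0 : ∀ k, f k ≠ z := by
    intro k h
    have h' : rowPerm (Ls k) (hL k) z (Ls k o z) = rowPerm (Ls k) (hL k) z (Ls k z z) := by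
      rw [rowPerm_apply]; exact h
    have h'' : Ls k o z = Ls k z z := (rowPerm (Ls k) (hL k) z).injective h'
    exact hzo ((hL k).2 z h'')
  have hfinj : Injective f := by
    intro k k' hkk
    by_contra hne
    have hO' := isOrthogonalMate_relabel (hO k k' hne) (rowPerm (Ls k) (hL k) z) (rowPerm (Ls k') (hL k') z)
    -- the pair at (o, z) equals the pair at (z, s) with s := f k
    have e := @hO' (o, z) (z, f k) (by
      simp only [Prod.mk.injEq]
      refine ⟨?_, ?_⟩
      · show f k = rowPerm (Ls k) (hL k) z (Ls k z (f k)); rw [rowPerm_apply]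
      · show rowPerm (Ls k') (hL k') z (Ls k' o z) = rowPerm (Ls k') (hL k') z (Ls k' z (f k))
        rw [rowPerm_apply]; exact hkk.symm ▸ rfl)
    exact hzo (congrArg Prod.fst e)
  -- an injection into the nonzero symbols
  let g : ι → {s : Fin n // s ≠ z} := fun k => ⟨f k, hf0 k⟩
  have hg : Injective g := fun k k' h => hfinj (congrArg Subtype.val h)
  have hcard := Fintype.card_le_of_injective g hg
  rw [Fintype.card_subtype_compl, Fintype.card_fin, Fintype.card_subtype_eq] at hcard
  exact hcard

/-- in particular a projective-plane-sized family (`n - 1` squares) is the maximum: `N(12) ≤ 11`, `N(10) ≤ 9` -/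
theorem card_MOLS_twelve_le [Fintype ι] (Ls : ι → Fin 12 → Fin 12 → Fin 12) (hL : ∀ k, IsLatinSquare (Ls k))
    (hO : ∀ k k', k ≠ k' → IsOrthogonalMate (Ls k) (Ls k')) : Fintype.card ι ≤ 11 :=
  card_MOLS_le Ls hL hO (by norm_num)

end Summit.Ventures.DiscreteObjects.MOLS
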